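import Literature.NumberTheory.EllipticCurves.ZpExtensionIdelicCharacterProofs
import Literature.NumberTheory.EllipticCurves.ZpExtensionPadicUnitsProofs
import Literature.NumberTheory.EllipticCurves.ZpExtensionDihedralProofs
import Literature.NumberTheory.EllipticCurves.ZpExtensionRatRankProofs
import Literature.NumberTheory.EllipticCurves.HeegnerPoints
import HarnessLib

/-!
# Two independent idelic characters of an imaginary quadratic field, and a rank-two lemma (proofs only)

Topic `NumberTheory/EllipticCurves` (Iwasawa theory of `ℤ_p`-extensions); namespace
`Literature.NumberTheory.EllipticCurves.ZpExtension`.  THEOREMS ONLY (no definition, no named fact,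
no instance; D-0026).  Second of three files discharging the named fact
`ZpExtension.decomp_not_le_kerSubgroup_of_isAnticyclotomic` (Brink 2007, Thm. 2); see
`ZpExtensionIdelicCharacterProofs.lean` (the idelic character `Λ = κ^ab ∘ [·, K]`) and
`AnticyclotomicPrimeDecompositionSplitProofs.lean` (the assembly).

* §1 **Linear algebra over `ℤ_p`.**  An additive map `ℤ_pⁿ → ℤ_p` is `ℤ_p`-linear
  (`⋂ₙ pⁿℤ_p = 0`, Serre, *Cours d'arithmétique* II §1); and the **rank-two lemma**: for a
  finite-index subgroup `W ≅ ℤ_p²` of a commutative group `U` and two `ℤ_p`-independent characters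
  `λ₁, λ₂ : U → ℤ_p`, an element killed by both is torsion (`y^{[U:W]} = 1`) — the shape of Lang's
  rank count (*Cyclotomic Fields I–II*, Ch. 5 §5, Thm. 5.2: independent `ℤ_p`-extensions ↔
  independent characters of `U_p ∼ ℤ_p^{[K:ℚ]}`).
* §2 **A `ℤ_p`-extension of `K` from `ℚ`** (`[K : ℚ] = 2`): `κ₀ ∘ res_{K/ℚ}` for a `ℤ_p`-extension
  `κ₀` of `ℚ` (tree: `nonempty_zpExtension_rat`) is non-trivial, hence `pᵏ` times a
  `ℤ_p`-extension `κ'` (saturation), and conjugation by `Γ_ℚ` FIXES `κ'` (Washington §13.1: the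
  cyclotomic `ℤ_p`-extension `K ℚ_∞`).
* §3 **Independence** (Brink 2007 §II Prop. 1: "`K^cycl` and `K^anti` are the only absolutely
  normal `ℤ_l`-extensions of `K` since `U` and `W` are the only `τ`-invariant subgroups of `U × W`
  with quotient `ℤ_l`"): for `K` imaginary quadratic, `κ` anticyclotomic (INVERTED by conjugation)
  and `κ'` fixed by conjugation, no non-trivial combination `a Λ + b Λ'` of their idelic characters
  kills the local units above `p` — else `χ = κ^a κ'^b` has an idelic character killing `U_p`, so
  `χ = 1` (non-vanishing, FILE 1 §3), and `a κ + b κ' = 0 = -a κ + b κ'` forces `a = b = 0`.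

## References

* D. Brink, *Prime decomposition in the anti-cyclotomic extension*, Math. Comp. 76 (2007), §II
  Prop. 1 (p. 2130). [Brink2007]
* S. Lang, *Cyclotomic Fields I and II*, GTM 121 (1990), Ch. 5 §5, Thm. 5.1–5.2. [Lang1990]
* L. C. Washington, *Introduction to Cyclotomic Fields* (1997), §13.1. [Washington1997]
* J.-P. Serre, *A Course in Arithmetic* (1973), Ch. II §1. [Serre1973]

## Tree search

`lean search 'addMonoidHom_padicInt|pow_index_eq_one_of|exists_zpExtension_fixed|eq_zero_of_forall_localUnits'`:
no prior hits; `apply_eq_sum_mul_of_continuous` (`ZpExtensionRankCFTProofs`) is the continuous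
version of §1 (continuity is automatic, proved here).
-/

noncomputable section

open Field NumberField IsDedekindDomain

namespace Literature.NumberTheory.EllipticCurves.ZpExtension

open Literature.NumberTheory.GaloisRepresentations Literature.NumberTheory.NumberFields

/-! ### §1. Additive maps `ℤ_pⁿ → ℤ_p` are `ℤ_p`-linear, and a rank-two lemma -/

section Linear

variable {p : ℕ} [Fact p.Prime]

/-- **An additive map `φ : ℤ_p → ℤ_p` is `ℤ_p`-linear**: `φ t = t · φ 1` (write `t = a + pⁿ s` with
`a ∈ ℕ`; then `φ t - t φ 1 = pⁿ (φ s - s φ 1)` is divisible by every `pⁿ`).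
Serre, *A Course in Arithmetic*, Ch. II §1 (`⋂ pⁿℤ_p = 0`). [cite: Serre1973, Ch. II §1.2 Prop. 2] -/
theorem addMonoidHom_padicInt_apply_eq_mul (φ : ℤ_[p] →+ ℤ_[p]) (t : ℤ_[p]) : φ t = t * φ 1 := by
  rw [← sub_eq_zero]
  refine PadicUnits.eq_zero_of_forall_pow_dvd fun n => ?_
  obtain ⟨s, hs⟩ := Ideal.mem_span_singleton'.mp (PadicInt.appr_spec n t)
  -- `t = a + p^n s` with `a = appr t n ∈ ℕ`
  have ht : t = (t.appr n : ℤ_[p]) + s * (p : ℤ_[p]) ^ n := by rw [hs]; ring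
  have hφa : φ (t.appr n : ℤ_[p]) = (t.appr n : ℤ_[p]) * φ 1 := by
    have h1 : (t.appr n : ℤ_[p]) = (t.appr n) • (1 : ℤ_[p]) := (nsmul_one _).symm
    conv_lhs => rw [h1]
    rw [map_nsmul, nsmul_eq_mul]
  have hφs : φ (s * (p : ℤ_[p]) ^ n) = (p : ℤ_[p]) ^ n * φ s := by
    rw [mul_comm s, ← Nat.cast_pow, ← nsmul_eq_mul, map_nsmul, nsmul_eq_mul]
  refine ⟨φ s - s * φ 1, ?_⟩
  conv_lhs => rw [ht]
  rw [map_add, hφa, hφs]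
  ring

/-- **An additive map `f : ℤ_pⁿ → ℤ_p` is `ℤ_p`-linear**: `f x = ∑ᵢ xᵢ f(eᵢ)`.
[cite: Serre1973, Ch. II §1.2 Prop. 2] -/
theorem addMonoidHom_pi_padicInt_apply_eq_sum {n : ℕ} (f : (Fin n → ℤ_[p]) →+ ℤ_[p])
    (x : Fin n → ℤ_[p]) : f x = ∑ i, x i * f (Pi.single i 1) := by
  classical
  have hsingle : ∀ i (t : ℤ_[p]), f (Pi.single i t) = t * f (Pi.single i 1) := by
    intro i t
    have h := addMonoidHom_padicInt_apply_eq_mul (f.comp (AddMonoidHom.single (fun _ => ℤ_[p]) i)) t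
    simpa only [AddMonoidHom.comp_apply, AddMonoidHom.single_apply] using h
  conv_lhs => rw [← Finset.univ_sum_single x]
  rw [map_sum]
  exact Finset.sum_congr rfl fun i _ => hsingle i (x i)

/-- **Rank-two lemma.**  Let `W ≤ U` be a finite-index subgroup of a commutative group with
`W ≅ ℤ_p²` and `λ₁, λ₂ : U → ℤ_p` two characters that are `ℤ_p`-independent
(`a λ₁ + b λ₂ = 0 ⇒ a = b = 0`).  Then their common kernel is torsion: if `λ₁ y = λ₂ y = 0` then
`y^{[U:W]} = 1` — two independent linear forms on `ℤ_p²` have only the common zero `0`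
(Lang, *Cyclotomic Fields I–II*, Ch. 5 §5, proof of Thm. 5.2: independent characters of a
`ℤ_p`-module of rank two cut out a finite subgroup). [cite: Lang1990, Ch. 5 §5, Thm. 5.2 (proof)] -/
theorem pow_index_eq_one_of_apply_eq_one {U : Type*} [CommGroup U] (W : Subgroup U) [W.FiniteIndex]
    (e : W ≃* Multiplicative (Fin 2 → ℤ_[p])) (l₁ l₂ : U →* Multiplicative ℤ_[p])
    (hind : ∀ a b : ℤ_[p], (∀ x : U, a * (l₁ x).toAdd + b * (l₂ x).toAdd = 0) → a = 0 ∧ b = 0)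
    {y : U} (h₁ : l₁ y = 1) (h₂ : l₂ y = 1) : y ^ W.index = 1 := by
  classical
  set m := W.index with hm
  have hm0 : (m : ℤ_[p]) ≠ 0 := Nat.cast_ne_zero.mpr Subgroup.FiniteIndex.index_ne_zero
  -- the additive avatars `f i : ℤ_p² →+ ℤ_p` of `λ i` on `W`
  let F : (U →* Multiplicative ℤ_[p]) → (Fin 2 → ℤ_[p]) →+ ℤ_[p] := fun l =>
    { toFun := fun x => (l (W.subtype (e.symm (Multiplicative.ofAdd x)))).toAdd
      map_zero' := by rw [ofAdd_zero, map_one, map_one, map_one, toAdd_one]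
      map_add' := fun x x' => by rw [ofAdd_add, map_mul, map_mul, map_mul, toAdd_mul] }
  have hF : ∀ (l : U →* Multiplicative ℤ_[p]) (w : W),
      F l (Multiplicative.toAdd (e w)) = (l (w : U)).toAdd := by
    intro l w
    change (l (W.subtype (e.symm (Multiplicative.ofAdd (Multiplicative.toAdd (e w)))))).toAdd = _
    rw [ofAdd_toAdd, e.symm_apply_apply, Subgroup.coe_subtype]
  -- linearity
  have hlin : ∀ (l : U →* Multiplicative ℤ_[p]) (x : Fin 2 → ℤ_[p]),
      F l x = x 0 * F l (Pi.single 0 1) + x 1 * F l (Pi.single 1 1) := by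
    intro l x
    rw [addMonoidHom_pi_padicInt_apply_eq_sum (F l) x, Fin.sum_univ_two]
  -- a relation on `ℤ_p²` transfers to `U`
  have hrel : ∀ a b : ℤ_[p], (∀ x, a * F l₁ x + b * F l₂ x = 0) → a = 0 ∧ b = 0 := by
    intro a b hab
    refine hind a b fun u => ?_
    have hu : u ^ m ∈ W := W.pow_index_mem u
    have h := hab (Multiplicative.toAdd (e ⟨u ^ m, hu⟩))
    rw [hF, hF] at h
    change a * (l₁ (u ^ m)).toAdd + b * (l₂ (u ^ m)).toAdd = 0 at h
    rw [map_pow l₁, map_pow l₂, toAdd_pow, toAdd_pow, nsmul_eq_mul, nsmul_eq_mul] at h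
    have h' : (m : ℤ_[p]) * (a * (l₁ u).toAdd + b * (l₂ u).toAdd) = 0 := by
      linear_combination h
    exact (mul_eq_zero.mp h').resolve_left hm0
  -- coefficients
  have hlin₁ : ∀ x, F l₁ x = x 0 * F l₁ (Pi.single 0 1) + x 1 * F l₁ (Pi.single 1 1) := hlin l₁
  have hlin₂ : ∀ x, F l₂ x = x 0 * F l₂ (Pi.single 0 1) + x 1 * F l₂ (Pi.single 1 1) := hlin l₂
  set c₁₀ := F l₁ (Pi.single 0 1)
  set c₁₁ := F l₁ (Pi.single 1 1)
  set c₂₀ := F l₂ (Pi.single 0 1)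
  set c₂₁ := F l₂ (Pi.single 1 1)
  -- the determinant is non-zero
  have hdet : c₁₀ * c₂₁ - c₁₁ * c₂₀ ≠ 0 := by
    intro hdet
    have h1 := hrel c₂₁ (-c₁₁) fun x => by
      rw [hlin₁, hlin₂]; linear_combination x 0 * hdet
    obtain ⟨h21, h11⟩ := h1
    rw [neg_eq_zero] at h11
    have h2 := hrel c₂₀ (-c₁₀) fun x => by
      rw [hlin₁, hlin₂, h21, h11]; ring
    obtain ⟨h20, h10⟩ := h2
    rw [neg_eq_zero] at h10
    have h3 := hrel 1 0 fun x => by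
      rw [hlin₁, h10, h11]; ring
    exact one_ne_zero h3.1
  -- the vector of `y^m` is killed by both forms, hence is zero
  have hy : y ^ m ∈ W := W.pow_index_mem y
  set z : Fin 2 → ℤ_[p] := Multiplicative.toAdd (e ⟨y ^ m, hy⟩) with hz
  have hz₁ : F l₁ z = 0 := by
    rw [hz, hF]; change (l₁ (y ^ m)).toAdd = 0; rw [map_pow, h₁, one_pow, toAdd_one]
  have hz₂ : F l₂ z = 0 := by
    rw [hz, hF]; change (l₂ (y ^ m)).toAdd = 0; rw [map_pow, h₂, one_pow, toAdd_one]
  rw [hlin₁] at hz₁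
  rw [hlin₂] at hz₂
  have hz0 : z 0 = 0 := by
    have h : (c₁₀ * c₂₁ - c₁₁ * c₂₀) * z 0 = 0 := by linear_combination c₂₁ * hz₁ - c₁₁ * hz₂
    exact (mul_eq_zero.mp h).resolve_left hdet
  have hz1 : z 1 = 0 := by
    have h : (c₁₀ * c₂₁ - c₁₁ * c₂₀) * z 1 = 0 := by linear_combination -c₂₀ * hz₁ + c₁₀ * hz₂
    exact (mul_eq_zero.mp h).resolve_left hdet
  have hzero : z = 0 := by
    funext i; fin_cases i
    · exact hz0
    · exact hz1
  have hem : e ⟨y ^ m, hy⟩ = 1 := by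
    rw [← ofAdd_toAdd (e ⟨y ^ m, hy⟩), ← hz, hzero, ofAdd_zero]
  have : (⟨y ^ m, hy⟩ : W) = 1 := e.injective (by rw [hem, map_one])
  exact congrArg Subtype.val this

end Linear

/-! ### §2. A `ℤ_p`-extension of an imaginary quadratic field coming from `ℚ` -/

section FromRat

variable {K : Type} [Field K] [NumberField K] {p : ℕ} [Fact p.Prime]

/-- **A `ℤ_p`-extension of the quadratic field `K` coming from `ℚ`** (the cyclotomic one): the
restriction `κ₀ ∘ res` to `Γ_K` of a `ℤ_p`-extension `κ₀` of `ℚ` (`nonempty_zpExtension_rat`) is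
non-trivial (`res(Γ_K)` has index `2` in `Γ_ℚ` and `ℤ_p` is torsion-free), hence `p^k` times a
`ℤ_p`-extension `κ'` of `K` (saturation); conjugation by any `g ∈ Γ_ℚ` fixes `κ'`
(`κ₀(g γ g⁻¹) = κ₀(γ)`).  Washington §13.1: `K_∞^{cyc} = K ℚ_∞`. [cite: Washington1997, §13.1] -/
theorem exists_zpExtension_fixed_by_conj (hK2 : Module.finrank ℚ K = 2) :
    ∃ κ' : ZpExtension K p, ∀ (g : absoluteGaloisGroup ℚ) (σ τ : absoluteGaloisGroup K),
      absGaloisRestrict ℚ K τ = g * absGaloisRestrict ℚ K σ * g⁻¹ → κ' τ = κ' σ := by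
  obtain ⟨κ₀⟩ := nonempty_zpExtension_rat (p := p)
  set χ : absoluteGaloisGroup K →ₜ* Multiplicative ℤ_[p] :=
    κ₀.toContinuousMonoidHom.comp (absGaloisRestrict ℚ K) with hχ
  have hχapply : ∀ σ, χ σ = κ₀ (absGaloisRestrict ℚ K σ) := fun σ => rfl
  -- `χ ≠ 1`: otherwise `κ₀` kills the index-two subgroup `res(Γ_K)`, hence `κ₀(g)² = 1` for all `g`
  haveI : FiniteDimensional ℚ K := Module.finite_of_finrank_eq_succ hK2
  have hχne : χ ≠ 1 := by
    intro h1
    have hidx : (absGaloisRestrict ℚ K).range.index = 2 := by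
      rw [index_range_absGaloisRestrict_eq_finrank, hK2]
    haveI : (absGaloisRestrict ℚ K).range.Normal := Subgroup.normal_of_index_eq_two hidx
    haveI : (absGaloisRestrict ℚ K).range.FiniteIndex := ⟨by rw [hidx]; norm_num⟩
    have hsq : ∀ g : absoluteGaloisGroup ℚ, (κ₀ g).toAdd = 0 := by
      intro g
      obtain ⟨σ, hσ⟩ := (absGaloisRestrict ℚ K).range.pow_index_mem g
      rw [hidx] at hσ
      have h2 : κ₀ (g ^ 2) = 1 := by
        rw [← hσ]
        change κ₀ (absGaloisRestrict ℚ K σ) = 1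
        rw [← hχapply, h1]; rfl
      rw [map_pow] at h2
      have h3 := congrArg Multiplicative.toAdd h2
      rw [toAdd_pow, toAdd_one, smul_eq_zero_iff_right two_ne_zero] at h3
      exact h3
    obtain ⟨g, hg⟩ := κ₀.surjective (Multiplicative.ofAdd 1)
    have h := hsq g
    change (κ₀.toContinuousMonoidHom g).toAdd = 0 at h
    rw [hg, toAdd_ofAdd] at h
    exact one_ne_zero h
  obtain ⟨χ', k, hsurj, hχ'⟩ := exists_surjective_of_ne_one χ hχne
  refine ⟨⟨χ', hsurj⟩, fun g σ τ hτ => ?_⟩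
  change χ' τ = χ' σ
  have hp0 : (p : ℤ_[p]) ^ k ≠ 0 := pow_ne_zero _ (Nat.cast_ne_zero.mpr (Fact.out : p.Prime).ne_zero)
  have h1 : (χ τ).toAdd = (χ σ).toAdd := by
    rw [hχapply, hχapply, hτ, map_mul κ₀, map_mul κ₀, map_inv κ₀, toAdd_mul, toAdd_mul, toAdd_inv]
    ring
  rw [hχ' τ, hχ' σ] at h1
  exact Multiplicative.toAdd.injective (mul_left_cancel₀ hp0 h1)

end FromRat

/-! ### §3. Independence of the anticyclotomic and cyclotomic idelic characters on `U_p` -/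

section Independence

variable {K : Type} [Field K] [NumberField K] {p : ℕ} [Fact p.Prime]

/-- **Independence on the local units above `p`.**  Let `K` be imaginary quadratic, `κ` an
anticyclotomic `ℤ_p`-extension (conjugation by `Γ_ℚ ∖ Γ_K` inverts it — Brink §II Prop. 1:
`K^anti` is pro-dihedral) and `κ'` a `ℤ_p`-extension fixed by conjugation (coming from `ℚ`), with
idelic characters `Λ, Λ'`.  If `a Λ + b Λ'` (additively) kills the local units above `p`, then
`a = b = 0`: the character `χ = κ^a κ'^b` would have an idelic character killing `U_p`, so `χ = 1`
(`exists_idelicCharacter_localUnits_ne_one` applied to its saturation); and `a κ + b κ' = 0`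
together with its conjugate `-a κ + b κ' = 0` forces `a = b = 0` (`κ, κ'` onto `ℤ_p`).  This is the
independence of `K^anti` and `K^cycl` (Brink §II Prop. 1: "`U` and `W` are the only `τ`-invariant
subgroups of `U × W` with quotient `ℤ_l`"). [cite: Brink2007, §II Prop. 1 (p. 2130)] -/
theorem eq_zero_of_forall_localUnits [IsGalois ℚ K] (hK : IsImaginaryQuadratic K)
    (κ : ZpExtension K p) (hκ : κ.IsAnticyclotomic) (κ' : ZpExtension K p)
    (hκ' : ∀ (g : absoluteGaloisGroup ℚ) (σ τ : absoluteGaloisGroup K),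
      absGaloisRestrict ℚ K τ = g * absGaloisRestrict ℚ K σ * g⁻¹ → κ' τ = κ' σ)
    {Λ Λ' : ideleGroup K →ₜ* Multiplicative ℤ_[p]}
    (hΛ : ∀ (a : ideleGroup K) (γ : absoluteGaloisGroup K),
      absGaloisAbProj K γ = ideleArtinMap K a → Λ a = κ.toContinuousMonoidHom γ)
    (hΛ' : ∀ (a : ideleGroup K) (γ : absoluteGaloisGroup K),
      absGaloisAbProj K γ = ideleArtinMap K a → Λ' a = κ'.toContinuousMonoidHom γ)
    {a b : ℤ_[p]}
    (h : ∀ (w : HeightOneSpectrum (𝓞 K)), ((p : ℕ) : 𝓞 K) ∈ w.asIdeal →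
      ∀ u : (w.adicCompletionIntegers K)ˣ,
        a * (Λ (localUnits w (Units.map ((w.adicCompletionIntegers K).subtype : _ →* _) u))).toAdd +
          b * (Λ' (localUnits w (Units.map ((w.adicCompletionIntegers K).subtype : _ →* _) u))).toAdd = 0) :
    a = 0 ∧ b = 0 := by
  haveI : IsTotallyComplex K := hK.2
  have hp : p.Prime := Fact.out
  -- Step 1: `a κ + b κ' = 0` on `Γ_K`
  have hsum : ∀ σ : absoluteGaloisGroup K, a * (κ σ).toAdd + b * (κ' σ).toAdd = 0 := by
    -- the character `χ = κ^a κ'^b`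
    let χ : absoluteGaloisGroup K →ₜ* Multiplicative ℤ_[p] :=
      { toFun := fun σ => Multiplicative.ofAdd (a * (κ σ).toAdd + b * (κ' σ).toAdd)
        map_one' := by rw [map_one κ, map_one κ', toAdd_one, mul_zero, mul_zero, add_zero, ofAdd_zero]
        map_mul' := fun σ τ => by
          rw [← ofAdd_add, map_mul κ, map_mul κ', toAdd_mul, toAdd_mul]; congr 1; ring
        continuous_toFun := continuous_ofAdd.comp
          (((continuous_const.mul (continuous_toAdd.comp (map_continuous κ))).add
            (continuous_const.mul (continuous_toAdd.comp (map_continuous κ'))))) }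
    have hχ : ∀ σ, (χ σ).toAdd = a * (κ σ).toAdd + b * (κ' σ).toAdd := fun σ => rfl
    by_cases hχ1 : χ = 1
    · intro σ
      rw [← hχ σ, hχ1]
      rfl
    · exfalso
      obtain ⟨χ₁, k, hsurj, hχ₁⟩ := exists_surjective_of_ne_one χ hχ1
      let κ₁ : ZpExtension K p := ⟨χ₁, hsurj⟩
      obtain ⟨Λ₁, hΛ₁⟩ := exists_idelicCharacter (κ₁.toContinuousMonoidHom)
      have hp0 : (p : ℤ_[p]) ^ k ≠ 0 := pow_ne_zero _ (Nat.cast_ne_zero.mpr hp.ne_zero)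
      obtain ⟨w, hw, u, hne⟩ := exists_idelicCharacter_localUnits_ne_one κ₁ hΛ₁
      apply hne
      set x := localUnits w (Units.map ((w.adicCompletionIntegers K).subtype : _ →* _) u)
      obtain ⟨γ, hγ, hΛ₁x⟩ := idelicCharacter_exists_eq hΛ₁ x
      have hΛx : Λ x = κ γ := hΛ x γ hγ
      have hΛ'x : Λ' x = κ' γ := hΛ' x γ hγ
      have h0 := h w hw u
      change a * (Λ x).toAdd + b * (Λ' x).toAdd = 0 at h0
      rw [hΛx, hΛ'x, ← hχ γ, hχ₁ γ, mul_eq_zero] at h0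
      rw [hΛ₁x]
      change χ₁ γ = 1
      exact Multiplicative.toAdd.injective ((h0.resolve_left hp0).trans toAdd_one.symm)
  -- Step 2: conjugate by `g ∈ Γ_ℚ ∖ res(Γ_K)`
  obtain ⟨g, hg, -⟩ := exists_not_mem_range_absGaloisRestrict K (Rat.castHom ℝ)
    (fun w => IsTotallyComplex.isComplex w)
  have hb : b = 0 := by
    obtain ⟨σ, hσ⟩ := κ'.surjective (Multiplicative.ofAdd 1)
    set τ := absGaloisConj (smul_absEmbedding_eq_absGaloisQuot ℚ K g) σ with hτdef
    have hτ : absGaloisRestrict ℚ K τ = g * absGaloisRestrict ℚ K σ * g⁻¹ :=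
      absGaloisRestrict_absGaloisConj _ σ
    have h1 := hsum σ
    have h2 := hsum τ
    rw [hκ σ τ g hg hτ, hκ' g σ τ hτ, toAdd_inv] at h2
    have hσ1 : (κ' σ).toAdd = 1 := by
      change (κ'.toContinuousMonoidHom σ).toAdd = 1; rw [hσ, toAdd_ofAdd]
    rw [hσ1] at h1 h2
    have h3 : (2 : ℤ_[p]) * b = 0 := by linear_combination h1 + h2
    exact (mul_eq_zero.mp h3).resolve_left two_ne_zero
  refine ⟨?_, hb⟩
  obtain ⟨σ, hσ⟩ := κ.surjective (Multiplicative.ofAdd 1)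
  have h1 := hsum σ
  have hσ1 : (κ σ).toAdd = 1 := by
    change (κ.toContinuousMonoidHom σ).toAdd = 1; rw [hσ, toAdd_ofAdd]
  rw [hb, hσ1, zero_mul, add_zero, mul_one] at h1
  exact h1

end Independence

end Literature.NumberTheory.EllipticCurves.ZpExtension

end
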